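import Summits.Ventures.QEC.Census.GB.PK21A1UB
import Summits.Ventures.QEC.Census.GB.PK21A2
import Summits.Ventures.QEC.Census.GB.PK21A3
import Summits.Ventures.QEC.Census.GB.PK21A4
import Summits.Ventures.QEC.Census.GB.PK21A5UB
import Summits.Ventures.QEC.Census.GB.PK21A6UB
import HarnessLib

/-!
# Panteleev–Kalachev Table 1 (generalized-bicycle rows A1–A6) in the kernel — one citable statement

[PanteleevKalachev2021] Quantum 5 (2021) 585 = arXiv:1904.02703, Table 1 (published p. 21; App. B chunk p0019 L1–40) prints for its
six GB codes A1 `[[254,28,14–20]]`, A2 `[[126,28,8]]`, A3 `[[48,6,8]]`, A4 `[[46,2,9]]`, A5 `[[180,10,15–18]]`, A6 `[[900,50,15]]`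
(distances by MILP/GLPK or Dumer–Kovalev–Pryadko-type bounds; for A1/A5 only an interval — exact `d` OPEN IN PRINT).
The six codes are typed as `BB.pk21A1 … BB.pk21A6 : BB.Code ℓ 1` (`Literature/…/GeneralizedBicycleCodesPK21.lean`, p527610).

This file only CONJOINS the six per-row kernel theorems already in the tree into one statement, `pk21_table1`:
* EXACT rows (census certificates transported to the typed objects): A2 `PK21A2.PK21A2_28_8_holds` (`Census/GB/PK21A2.lean`),
  A3 `PK21A3.PK21A3_6_8_holds` (`PK21A3.lean`), A4 `PK21A4.PK21A4_2_9_holds` (`PK21A4.lean`) — `BB.HasParams C n k d`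
  (`n ∧ k ∧ d =`), i.e. the printed `8 / 8 / 9` REPRODUCED;
* UPPER-BOUND rows (printed upper value reproduced, printed `k` exact; no lower-bound / exactness claim): A1 `PK21A1.PK21A1_28_le20_holds`,
  A5 `PK21A5.PK21A5_10_le18_holds`, A6 `PK21A6.PK21A6_50_le15_holds` (qec-search-2 g4) — `BB.HasParamsUB C n k d` (`n ∧ k ∧ d ≤`).

No new certificate and no new mathematics — tier KERNEL, axioms standard. HONEST FRAMING: A1, A5, A6 remain upper bounds in the kernel
exactly as (or weaker than) printed: A6 is printed EXACT `15` but certified here only as `d ≤ 15`; A1/A5 carry the printed upper ends `20 / 18`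
and nothing is claimed about the printed lower ends `14 / 15`. qec-search-2 g5.
-/

namespace Summit.Ventures.QEC.Census.PK21Table1

open Literature.InformationTheory.QuantumCodes Summit.Ventures.QEC

/-- **Panteleev–Kalachev Table 1, GB rows A1–A6, as kernel facts on the typed codes**: A2 `[[126,28,8]]`, A3 `[[48,6,8]]`,
A4 `[[46,2,9]]` hold EXACTLY; A1 `[[254,28,≤20]]`, A5 `[[180,10,≤18]]`, A6 `[[900,50,≤15]]` hold as upper-bound rows
(`k` exact, `d ≤` printed upper value). -/
theorem pk21_table1 :
    BB.HasParams BB.pk21A2 126 28 8 ∧ BB.HasParams BB.pk21A3 48 6 8 ∧ BB.HasParams BB.pk21A4 46 2 9 ∧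
    BB.HasParamsUB BB.pk21A1 254 28 20 ∧ BB.HasParamsUB BB.pk21A5 180 10 18 ∧ BB.HasParamsUB BB.pk21A6 900 50 15 :=
  ⟨PK21A2.PK21A2_28_8_holds, PK21A3.PK21A3_6_8_holds, PK21A4.PK21A4_2_9_holds,
   PK21A1.PK21A1_28_le20_holds, PK21A5.PK21A5_10_le18_holds, PK21A6.PK21A6_50_le15_holds⟩

/-- The three exact rows alone (A2, A3, A4). -/
theorem pk21_table1_exact :
    BB.HasParams BB.pk21A2 126 28 8 ∧ BB.HasParams BB.pk21A3 48 6 8 ∧ BB.HasParams BB.pk21A4 46 2 9 :=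
  ⟨pk21_table1.1, pk21_table1.2.1, pk21_table1.2.2.1⟩

end Summit.Ventures.QEC.Census.PK21Table1
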